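import Mathlib
import HarnessLib
import Literature.NumberTheory.LFunctions.ZetaScrew
import Summits.RiemannHypothesis.RiemannHypothesis.Theorems.IntegerScrewKNodeForm
import Summits.RiemannHypothesis.RiemannHypothesis.Theorems.IntegerScrewIncrementCovLag
import Summits.RiemannHypothesis.RiemannHypothesis.Theorems.IntegerScrewHingeCovariance

/-!
# Route `IntegerScrew` — the ARITHMETIC FLOOR of the pivot deficit from ONE prime power:
# `liminf G(M)·log M ≥ Λ(n)²/n²` (PIVOT-LAW §15.14; RH-FREE given `S_{M−1} ≻ 0`)

The hinge carrier `I_c`, `c = ⌈M/n⌉`, has `M·Cov(I_M, I_c) → −Λ(n)/√n`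
(`IntegerScrewHingeCovariance.tendsto_hingeCov`) and variance `M·2Ψ(h_c) = (M/c)·L(c) ∼ n·log M`.
The two-increment trial vector `I_M + τ·I_c` in the variational bound for the pivot
(`screwPivot_le_farTwoIncrement`, from `IntegerScrewKNodeForm.screwPivot_add_two_le_natForm` with the
four-point support `{c−1, c, M−1, M}` and the zero-sum cancellation) therefore gains, at the optimal `τ`,
`M·Cov²/(M·2Ψ(h_c)) ∼ Λ(n)²/(n²·log M)`:

* `eventually_hinge_deficit_floor` : for `n ≥ 2`, `1 ≤ j ≤ n` and every `ε > 0`, eventually in `r`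
  (`M = n r + j`): `S_{M−1} ≻ 0 → Λ(n)²/n² − ε ≤ G(M)·log M`, `G(M) = M·(2Ψ(log(M/(M−1))) − d_M)`.

This is the first SIZE statement about the pivot in which the primes enter (through `Λ`): every prime
power `q` alone keeps the deficit above `Λ(q)²/(q² log M)`; by PIVOT-LAW §15.14 [DERIVED] these
directions and the neighbours of §15.3 are orthogonal to leading order, so the floors add up to
`V/2 + Σ_q Λ(q)²/q² = 0.649 + 0.805` (kernel: the joint trial lemma is not yet written).  Lower bounds on
`G` point away from RH; nothing here bears on the truth of RH. [Suzuki2023, (1.1), (1.4)]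
-/

noncomputable section

-- D-0017: `Summit.<S>.<S>.…` is the designed namespace of a single-problem summit.
set_option linter.dupNamespace false

namespace Summit.RiemannHypothesis.RiemannHypothesis.Theorems.IntegerScrew

open Literature.NumberTheory.LFunctions Filter Finset
open scoped Topology

/-! ### A double sum over `Icc 2 N` of a function supported on four points -/

/-- A sum over `Icc 2 N` of terms vanishing off a subset `S ⊆ Icc 2 N` is the sum over `S`. [folklore] -/
private theorem sum_Icc_eq_sum_of_support {N : ℕ} (S : Finset ℕ) (hS : S ⊆ Icc 2 N) (g : ℕ → ℝ)
    (hg : ∀ m ∈ Icc 2 N, m ∉ S → g m = 0) : ∑ m ∈ Icc 2 N, g m = ∑ m ∈ S, g m :=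
  (Finset.sum_subset hS hg).symm

/-- **TWO-INCREMENT TRIAL INEQUALITY WITH A FAR NODE.**  For `3 ≤ c`, `c + 2 ≤ M` and `S_{M−1} ≻ 0`,
for every `τ : ℝ`:
`d_M ≤ 2Ψ(log(M/(M−1))) + τ²·2Ψ(log(c/(c−1))) + 2τ·(Ψ(log(M/(c−1))) + Ψ(log((M−1)/c)) − Ψ(log(M/c)) − Ψ(log((M−1)/(c−1))))`
— the squared length of `I_M + τ·I_c` on the screw line. [folklore] -/
theorem screwPivot_le_farTwoIncrement (M c : ℕ) (hc : 3 ≤ c) (hcM : c + 2 ≤ M)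
    (hPD : (screwMatrix (M - 2)).PosDef) (τ : ℝ) :
    screwPivot M ≤ 2 * zetaScrew (Real.log ((M : ℝ) / ((M : ℝ) - 1)))
      + τ ^ 2 * (2 * zetaScrew (Real.log ((c : ℝ) / ((c : ℝ) - 1))))
      + 2 * τ * (zetaScrew (Real.log ((M : ℝ) / ((c : ℝ) - 1)))
          + zetaScrew (Real.log (((M : ℝ) - 1) / (c : ℝ)))
          - zetaScrew (Real.log ((M : ℝ) / (c : ℝ)))
          - zetaScrew (Real.log (((M : ℝ) - 1) / ((c : ℝ) - 1)))) := by
  obtain ⟨n, rfl⟩ : ∃ n, M = n + 2 := ⟨M - 2, by omega⟩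
  have hn2 : n + 2 - 2 = n := by omega
  rw [hn2] at hPD
  -- node coefficients: 1 at M, −1 at M−1, τ at c, −τ at c−1
  set x : ℕ → ℝ := fun m => if m = n + 2 then 1 else if m = n + 1 then -1 else
    if m = c then τ else if m = c - 1 then -τ else 0 with hxdef
  have hxM : x (n + 2) = 1 := by simp [hxdef]
  have h1 := screwPivot_add_two_le_natForm n hPD x hxM
  -- the support S = {c−1, c, n+1, n+2}
  set S : Finset ℕ := {c - 1, c, n + 1, n + 2} with hSdef
  have hS : S ⊆ Icc 2 (n + 2) := by
    intro m hm
    simp only [hSdef, Finset.mem_insert, Finset.mem_singleton] at hm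
    rw [Finset.mem_Icc]; omega
  have hx0 : ∀ m ∈ Icc 2 (n + 2), m ∉ S → x m = 0 := by
    intro m _ hm
    simp only [hSdef, Finset.mem_insert, Finset.mem_singleton, not_or] at hm
    simp [hxdef, hm.1, hm.2.1, hm.2.2.1, hm.2.2.2]
  -- restrict both sums to S
  have hform : ∑ m ∈ Icc 2 (n + 2), ∑ m' ∈ Icc 2 (n + 2),
      zetaScrewKernel (Real.log m) (Real.log m') * (x m * x m')
      = ∑ m ∈ S, ∑ m' ∈ S, zetaScrewKernel (Real.log m) (Real.log m') * (x m * x m') := by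
    rw [sum_Icc_eq_sum_of_support S hS _ (fun m hm hmS => by
      rw [Finset.sum_eq_zero (fun m' _ => by rw [hx0 m hm hmS]; ring)])]
    exact Finset.sum_congr rfl fun m _ => sum_Icc_eq_sum_of_support S hS _ (fun m' hm' hm'S => by
      rw [hx0 m' hm' hm'S]; ring)
  -- zero sum ⇒ kernel form = −ΣΣ Ψ(log m − log m') x x
  have hsum : ∑ m ∈ S, x m = 0 := by
    have h12 : c - 1 ∉ ({c, n + 1, n + 2} : Finset ℕ) := by simp; omega
    have h2 : c ∉ ({n + 1, n + 2} : Finset ℕ) := by simp; omega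
    have h3 : n + 1 ∉ ({n + 2} : Finset ℕ) := by simp
    rw [hSdef, Finset.sum_insert h12, Finset.sum_insert h2, Finset.sum_insert h3, Finset.sum_singleton]
    have e1 : x (n + 2) = 1 := hxM
    have e2 : x (n + 1) = -1 := by simp [hxdef]
    have e3 : x c = τ := by simp [hxdef, show c ≠ n + 2 by omega, show c ≠ n + 1 by omega]
    have e4 : x (c - 1) = -τ := by
      simp [hxdef, show c - 1 ≠ n + 2 by omega, show c - 1 ≠ n + 1 by omega, show c - 1 ≠ c by omega]
    rw [e1, e2, e3, e4]; ring
  rw [hform, sum_kernel_eq_neg_sum_of_sum_eq_zero S x hsum] at h1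
  -- expand the 4 × 4 double sum
  have h12 : c - 1 ∉ ({c, n + 1, n + 2} : Finset ℕ) := by simp; omega
  have h2 : c ∉ ({n + 1, n + 2} : Finset ℕ) := by simp; omega
  have h3 : n + 1 ∉ ({n + 2} : Finset ℕ) := by simp
  have e1 : x (n + 2) = 1 := hxM
  have e2 : x (n + 1) = -1 := by simp [hxdef]
  have e3 : x c = τ := by simp [hxdef, show c ≠ n + 2 by omega, show c ≠ n + 1 by omega]
  have e4 : x (c - 1) = -τ := by
    simp [hxdef, show c - 1 ≠ n + 2 by omega, show c - 1 ≠ n + 1 by omega, show c - 1 ≠ c by omega]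
  simp only [hSdef, Finset.sum_insert h12, Finset.sum_insert h2, Finset.sum_insert h3,
    Finset.sum_singleton, e1, e2, e3, e4] at h1
  -- casts and log differences
  have hc' : (3 : ℝ) ≤ (c : ℝ) := by exact_mod_cast hc
  have hcM' : (c : ℝ) + 2 ≤ ((n + 2 : ℕ) : ℝ) := by exact_mod_cast hcM
  have hc1 : ((c - 1 : ℕ) : ℝ) = (c : ℝ) - 1 := by rw [Nat.cast_sub (by omega), Nat.cast_one]
  have hn1 : ((n + 1 : ℕ) : ℝ) = ((n + 2 : ℕ) : ℝ) - 1 := by push_cast; ring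
  set Mr : ℝ := ((n + 2 : ℕ) : ℝ) with hMr
  have hMr0 : 0 < Mr := by linarith
  have hMr1 : 0 < Mr - 1 := by linarith
  have hcr0 : 0 < (c : ℝ) := by linarith
  have hcr1 : 0 < (c : ℝ) - 1 := by linarith
  rw [hc1, hn1] at h1
  -- Ψ(log a − log b) = Ψ(log(a/b)) and symmetry/zero
  have hL : ∀ {a b : ℝ}, 0 < a → 0 < b → zetaScrew (Real.log a - Real.log b) = zetaScrew (Real.log (a / b)) := by
    intro a b ha hb; rw [Real.log_div ha.ne' hb.ne']
  have hsym : ∀ u v : ℝ, zetaScrew (u - v) = zetaScrew (v - u) := fun u v => by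
    rw [← zetaScrew_neg, neg_sub]
  simp only [sub_self, zetaScrew_zero] at h1
  rw [hsym (Real.log (Mr - 1)) (Real.log Mr), hsym (Real.log ((c : ℝ) - 1)) (Real.log (c : ℝ)),
    hsym (Real.log ((c : ℝ) - 1)) (Real.log Mr), hsym (Real.log (c : ℝ)) (Real.log Mr),
    hsym (Real.log ((c : ℝ) - 1)) (Real.log (Mr - 1)), hsym (Real.log (c : ℝ)) (Real.log (Mr - 1)),
    hL hMr0 hMr1, hL hcr0 hcr1, hL hMr0 hcr1, hL hMr1 hcr0, hL hMr0 hcr0, hL hMr1 hcr1] at h1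
  linarith [h1]

/-! ### The one-prime arithmetic floor -/

/-- `r ↦ n·r + j` tends to infinity for `n ≥ 1`. [folklore] -/
private theorem tendsto_const_mul_add_nat' {n : ℕ} (hn : 1 ≤ n) (j : ℕ) :
    Tendsto (fun r : ℕ => n * r + j) atTop atTop :=
  Filter.tendsto_atTop_mono (fun r => (Nat.le_mul_of_pos_left r (by omega)).trans
    (Nat.le_add_right _ _)) tendsto_id

/-- **THE ARITHMETIC FLOOR FROM ONE PRIME POWER** (PIVOT-LAW §15.14).  For `n ≥ 2`, `1 ≤ j ≤ n` and
`ε > 0`, eventually in `r` (`M = n r + j`, every residue class of `M` mod `n` as `j` runs over `1…n`):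
`S_{M−1} ≻ 0 → Λ(n)²/n² − ε ≤ G(M)·log M`, `G(M) = M·(2Ψ(log(M/(M−1))) − d_M)` — trial vector
`I_M + τ I_{⌈M/n⌉}` at the optimal `τ`.  (`Λ(n) = 0` unless `n` is a prime power; for `n = p^k` the
floor is `(log p)²/p^{2k}`: `0.1201` for `2`, `0.1341` for `3`, `0.1036` for `5`.) [folklore] -/
theorem eventually_hinge_deficit_floor {n j : ℕ} (hn : 2 ≤ n) (hj1 : 1 ≤ j) (hjn : j ≤ n)
    (ε : ℝ) (hε : 0 < ε) :
    ∀ᶠ r : ℕ in atTop, (screwMatrix (n * r + j - 2)).PosDef →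
      (ArithmeticFunction.vonMangoldt n) ^ 2 / (n : ℝ) ^ 2 - ε ≤
        ((n * r + j : ℕ) : ℝ) * (2 * zetaScrew (Real.log (((n * r + j : ℕ) : ℝ) / (((n * r + j : ℕ) : ℝ) - 1)))
          - screwPivot (n * r + j)) * Real.log ((n * r + j : ℕ) : ℝ) := by
  set κ : ℝ := ArithmeticFunction.vonMangoldt n / Real.sqrt n with hκ
  have hn' : (2 : ℝ) ≤ (n : ℝ) := by exact_mod_cast hn
  have hn0 : (0 : ℝ) < n := by linarith
  have hj' : (1 : ℝ) ≤ (j : ℝ) := by exact_mod_cast hj1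
  have hjn' : (j : ℝ) ≤ (n : ℝ) := by exact_mod_cast hjn
  have hcastM : ∀ r : ℕ, ((n * r + j : ℕ) : ℝ) = (n : ℝ) * r + j := fun r => by push_cast; ring
  -- (a) C(r) := M·Cov(I_M, I_{r+1}) → −κ
  have hC : Tendsto (fun r : ℕ => ((n * r + j : ℕ) : ℝ) *
      (zetaScrew (Real.log (((n * r + j : ℕ) : ℝ) / (((r + 1 : ℕ) : ℝ) - 1)))
        + zetaScrew (Real.log ((((n * r + j : ℕ) : ℝ) - 1) / ((r + 1 : ℕ) : ℝ)))
        - zetaScrew (Real.log (((n * r + j : ℕ) : ℝ) / ((r + 1 : ℕ) : ℝ)))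
        - zetaScrew (Real.log ((((n * r + j : ℕ) : ℝ) - 1) / (((r + 1 : ℕ) : ℝ) - 1)))))
      atTop (𝓝 (-κ)) := by
    refine (tendsto_hingeCov hn hj1 hjn).congr fun r => ?_
    simp only [hcastM, Nat.cast_add, Nat.cast_one, add_sub_cancel_right]
  -- (b) W(r) := M·2Ψ(h_{r+1}); W/log M → n
  have hlogM : Tendsto (fun r : ℕ => Real.log ((n * r + j : ℕ) : ℝ)) atTop atTop :=
    (Real.tendsto_log_atTop.comp tendsto_natCast_atTop_atTop).comp
      (tendsto_const_mul_add_nat' (by omega : 1 ≤ n) j)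
  have hW : Tendsto (fun r : ℕ => ((n * r + j : ℕ) : ℝ) *
      (2 * zetaScrew (Real.log (((r + 1 : ℕ) : ℝ) / (((r + 1 : ℕ) : ℝ) - 1))))
        / Real.log ((n * r + j : ℕ) : ℝ)) atTop (𝓝 (n : ℝ)) := by
    -- E(r) := (r+1)·2Ψ(h_{r+1}) − log(r+1) → −c₀ ; log(r+1)/log M → 1 ; M/(r+1) → n
    have hE := tendsto_incrementEnergy_sub_log.comp (tendsto_add_atTop_nat 1)
    have hE' : Tendsto (fun r : ℕ => ((((r + 1 : ℕ) : ℝ) *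
        (2 * zetaScrew (Real.log (((r + 1 : ℕ) : ℝ) / (((r + 1 : ℕ) : ℝ) - 1))))
        - Real.log ((r + 1 : ℕ) : ℝ)) / Real.log ((n * r + j : ℕ) : ℝ))) atTop (𝓝 0) :=
      hE.div_atTop hlogM
    -- log(r+1)/log M → 1:  log M − log(r+1) = log(M/(r+1)) is bounded (→ log n)
    have hratio : Tendsto (fun r : ℕ => Real.log ((r + 1 : ℕ) : ℝ) / Real.log ((n * r + j : ℕ) : ℝ))
        atTop (𝓝 1) := by
      have hq : Tendsto (fun r : ℕ => ((n * r + j : ℕ) : ℝ) / ((r + 1 : ℕ) : ℝ)) atTop (𝓝 (n : ℝ)) := by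
        have h1 : Tendsto (fun r : ℕ => ((n : ℝ) + ((j : ℝ) - n) / ((r : ℝ) + 1))) atTop
            (𝓝 ((n : ℝ) + 0)) := by
          refine tendsto_const_nhds.add (tendsto_const_nhds.div_atTop ?_)
          have := tendsto_atTop_add_const_right atTop (1 : ℝ) tendsto_natCast_atTop_atTop
          simpa using this
        rw [add_zero] at h1
        refine h1.congr fun r => ?_
        rw [hcastM]; push_cast
        field_simp
        ring
      have hlogq : Tendsto (fun r : ℕ => Real.log (((n * r + j : ℕ) : ℝ) / ((r + 1 : ℕ) : ℝ)))
          atTop (𝓝 (Real.log n)) := (Real.continuousAt_log hn0.ne').tendsto.comp hq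
      have h0 : Tendsto (fun r : ℕ => Real.log (((n * r + j : ℕ) : ℝ) / ((r + 1 : ℕ) : ℝ))
          / Real.log ((n * r + j : ℕ) : ℝ)) atTop (𝓝 0) := hlogq.div_atTop hlogM
      have h1 : Tendsto (fun r : ℕ => 1 - Real.log (((n * r + j : ℕ) : ℝ) / ((r + 1 : ℕ) : ℝ))
          / Real.log ((n * r + j : ℕ) : ℝ)) atTop (𝓝 (1 - 0)) := tendsto_const_nhds.sub h0
      rw [sub_zero] at h1
      refine h1.congr' ?_
      filter_upwards [eventually_ge_atTop 1] with r hr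
      have hr1 : (0 : ℝ) < ((r + 1 : ℕ) : ℝ) := by positivity
      have hM1 : (1 : ℝ) < ((n * r + j : ℕ) : ℝ) := by
        rw [hcastM]; have : (1 : ℝ) ≤ r := by exact_mod_cast hr
        nlinarith
      have hM0 : (0 : ℝ) < ((n * r + j : ℕ) : ℝ) := by linarith
      have hlog0 : Real.log ((n * r + j : ℕ) : ℝ) ≠ 0 := (Real.log_pos hM1).ne'
      rw [Real.log_div hM0.ne' hr1.ne']
      field_simp
      ring
    have hq2 : Tendsto (fun r : ℕ => ((n * r + j : ℕ) : ℝ) / ((r + 1 : ℕ) : ℝ)) atTop (𝓝 (n : ℝ)) := by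
      have h1 : Tendsto (fun r : ℕ => ((n : ℝ) + ((j : ℝ) - n) / ((r : ℝ) + 1))) atTop
          (𝓝 ((n : ℝ) + 0)) := by
        refine tendsto_const_nhds.add (tendsto_const_nhds.div_atTop ?_)
        have := tendsto_atTop_add_const_right atTop (1 : ℝ) tendsto_natCast_atTop_atTop
        simpa using this
      rw [add_zero] at h1
      refine h1.congr fun r => ?_
      rw [hcastM]; push_cast
      field_simp
      ring
    have htot := hq2.mul (hE'.add hratio)
    rw [zero_add, mul_one] at htot
    refine htot.congr' ?_
    filter_upwards [eventually_ge_atTop 1] with r hr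
    have hr1 : (0 : ℝ) < ((r + 1 : ℕ) : ℝ) := by positivity
    have hM1 : (1 : ℝ) < ((n * r + j : ℕ) : ℝ) := by
      rw [hcastM]; have : (1 : ℝ) ≤ r := by exact_mod_cast hr
      nlinarith
    have hlog0 : Real.log ((n * r + j : ℕ) : ℝ) ≠ 0 := (Real.log_pos hM1).ne'
    field_simp
    ring
  -- (c) the gain C²·log M/W → κ²/n = Λ(n)²/n²
  have hgain : Tendsto (fun r : ℕ => (((n * r + j : ℕ) : ℝ) *
      (zetaScrew (Real.log (((n * r + j : ℕ) : ℝ) / (((r + 1 : ℕ) : ℝ) - 1)))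
        + zetaScrew (Real.log ((((n * r + j : ℕ) : ℝ) - 1) / ((r + 1 : ℕ) : ℝ)))
        - zetaScrew (Real.log (((n * r + j : ℕ) : ℝ) / ((r + 1 : ℕ) : ℝ)))
        - zetaScrew (Real.log ((((n * r + j : ℕ) : ℝ) - 1) / (((r + 1 : ℕ) : ℝ) - 1))))) ^ 2
      * (Real.log ((n * r + j : ℕ) : ℝ) / (((n * r + j : ℕ) : ℝ) *
        (2 * zetaScrew (Real.log (((r + 1 : ℕ) : ℝ) / (((r + 1 : ℕ) : ℝ) - 1))))))) atTop
      (𝓝 ((-κ) ^ 2 * (n : ℝ)⁻¹)) := by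
    refine (hC.pow 2).mul ?_
    have := hW.inv₀ hn0.ne'
    refine this.congr fun r => ?_
    rw [inv_div]
  have hval : (-κ) ^ 2 * (n : ℝ)⁻¹ = (ArithmeticFunction.vonMangoldt n) ^ 2 / (n : ℝ) ^ 2 := by
    rw [neg_sq, hκ, div_pow, Real.sq_sqrt hn0.le]
    field_simp
  rw [hval] at hgain
  -- (d) eventually: the gain is ≥ Λ²/n² − ε, and the trial inequality applies
  filter_upwards [hgain.eventually (lt_mem_nhds (sub_lt_self _ hε)), eventually_ge_atTop 2]
    with r hg hr2 hPD
  set M : ℕ := n * r + j with hMdef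
  have hMr : ((M : ℕ) : ℝ) = (n : ℝ) * r + j := hcastM r
  have hr2' : (2 : ℝ) ≤ (r : ℝ) := by exact_mod_cast hr2
  have hM3 : (5 : ℝ) ≤ (M : ℝ) := by rw [hMr]; nlinarith
  have hM0 : (0 : ℝ) < (M : ℝ) := by linarith
  have hL0 : 0 < Real.log (M : ℝ) := Real.log_pos (by linarith)
  -- the trial inequality with c = r + 1
  have hc3 : 3 ≤ r + 1 := by omega
  have hcM : r + 1 + 2 ≤ M := by rw [hMdef]; nlinarith
  have htrial := screwPivot_le_farTwoIncrement M (r + 1) hc3 hcM hPD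
  -- abbreviations
  set A : ℝ := zetaScrew (Real.log ((M : ℝ) / ((M : ℝ) - 1))) with hA
  set B : ℝ := zetaScrew (Real.log (((r + 1 : ℕ) : ℝ) / (((r + 1 : ℕ) : ℝ) - 1))) with hB
  set Cv : ℝ := zetaScrew (Real.log ((M : ℝ) / (((r + 1 : ℕ) : ℝ) - 1)))
    + zetaScrew (Real.log (((M : ℝ) - 1) / ((r + 1 : ℕ) : ℝ)))
    - zetaScrew (Real.log ((M : ℝ) / ((r + 1 : ℕ) : ℝ)))
    - zetaScrew (Real.log (((M : ℝ) - 1) / (((r + 1 : ℕ) : ℝ) - 1))) with hCv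
  -- B > 0 (0 < h_{r+1} ≤ log 2)
  have hr0 : (0 : ℝ) < (r : ℝ) := by linarith
  have hB0 : 0 < B := by
    have hc1 : ((r + 1 : ℕ) : ℝ) - 1 = r := by push_cast; ring
    have hc0 : ((r + 1 : ℕ) : ℝ) = (r : ℝ) + 1 := by push_cast; ring
    rw [hB, hc1, hc0]
    apply Suzuki2023Thm41.zetaScrew_pos_of_le_log_two
    · apply Real.log_pos; rw [lt_div_iff₀ hr0]; linarith
    · apply Real.log_le_log (by positivity); rw [div_le_iff₀ hr0]; linarith
  -- optimal τ: d ≤ 2A − Cv²/(2B)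
  have hopt : screwPivot M ≤ 2 * A - Cv ^ 2 / (2 * B) := by
    have h := htrial (-(Cv / (2 * B)))
    have e : 2 * A + (-(Cv / (2 * B))) ^ 2 * (2 * B) + 2 * (-(Cv / (2 * B))) * Cv
        = 2 * A - Cv ^ 2 / (2 * B) := by
      field_simp; ring
    rw [← e]; exact h
  -- G·log M ≥ (M·Cv)²·log M/(M·2B)
  have hG : ((M : ℝ) * Cv) ^ 2 * (Real.log (M : ℝ) / ((M : ℝ) * (2 * B)))
      ≤ (M : ℝ) * (2 * A - screwPivot M) * Real.log (M : ℝ) := by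
    have h1 : (M : ℝ) * (Cv ^ 2 / (2 * B)) ≤ (M : ℝ) * (2 * A - screwPivot M) :=
      mul_le_mul_of_nonneg_left (by linarith) hM0.le
    have e : ((M : ℝ) * Cv) ^ 2 * (Real.log (M : ℝ) / ((M : ℝ) * (2 * B)))
        = (M : ℝ) * (Cv ^ 2 / (2 * B)) * Real.log (M : ℝ) := by
      field_simp
    rw [e]
    exact mul_le_mul_of_nonneg_right h1 hL0.le
  exact hg.le.trans hG

end Summit.RiemannHypothesis.RiemannHypothesis.Theorems.IntegerScrew
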